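import Summits.ResolutionOfSingularities.ResolutionOfSingularities.Theorems.MarkedTransferCampaignW46ThreefoldsGammaFreeGlobal
import Summits.ResolutionOfSingularities.ResolutionOfSingularities.Theses.MarkedTransfer
import Literature.AlgebraicGeometry.Resolution.KollarBlowupSequenceFunctors
import HarnessLib

/-!
# [OURS · L1 W4.6 rung (ii)] CALIBRATION LEAF for `GammaFreeGlobalOrderReductionDimLeThree p`: the host item stmt-16156
# implies it (one theorem; this leaf imports the route file, the statement module does not)

Cell res-hironaka, LADDER-RESOLUTION rung L (D-0089), slot W4.6, rung (ii); typer res-L1-type-o1 (statement-only lane; this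
is the STRENGTH CERTIFICATE of a typed OURS statement, not a result about resolution). Host route MarkedTransfer, host item
`HypersurfaceOrderReductionDimLeThree` (stmt-ResolutionOfSingularities-16156); `--supports` it. Companion of
`…ThreefoldsGammaFreeGlobal.lean` (the route-independent statement module: `IsPermissibleBlowupSeq`,
`GammaFreeGlobalOrderReductionDimLeThree`, calibration core `isPermissibleBlowupSeq_and_idealOrder_lt_of_isMarkedResolution`).
Kept as a separate LEAF so that the statement module stays out of the Theses cone (gate lint `theses-cone`): nobody needs to
import this file. Content: `HypersurfaceOrderReductionDimLeThree → ∀ p, GammaFreeGlobalOrderReductionDimLeThree.{0} p`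
(empty boundary; a BGMW marked resolution is a sequence of permissible blowing-ups ending below order `m`) — so the repaired
OURS statement of OURS-desk #86 is WEAKER than the known case [CossartJannsenSaito2020, KawanoueMatsuki2016], never
stronger. The host item is a HYPOTHESIS (open in the tree); nothing of H. Hironaka's manuscript is used or asserted.
AI-written; AI review is weaker than expert review. [Hironaka2017] — scope only.
-/

noncomputable section

set_option linter.dupNamespace false -- mandated namespace of this single-conjunct summit

open CategoryTheory AlgebraicGeometry TopologicalSpace

namespace Summit.ResolutionOfSingularities.ResolutionOfSingularities.Theorems

namespace CampaignW46

open Literature.AlgebraicGeometry.Resolution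
open Scheme.IdealSheafData
open Literature.AlgebraicGeometry.Hironaka2017

universe u

/-! ## The host item implies the global form -/

/-- **CALIBRATION: the host item implies the global Γ-free shadow.** `HypersurfaceOrderReductionDimLeThree →
GammaFreeGlobalOrderReductionDimLeThree p` for every `p` (empty boundary `E := []`, `hasSNC_nil_of_isRegular`; then
`isPermissibleBlowupSeq_and_idealOrder_lt_of_isMarkedResolution`). So the repaired OURS statement is WEAKER than the known
case [CossartJannsenSaito2020, KawanoueMatsuki2016], never stronger; the host item enters only as the hypothesis `h`
(open in the tree). [folklore] -/
theorem gammaFreeGlobal_of_hypersurfaceOrderReductionDimLeThree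
    (h : Theses.MarkedTransfer.HypersurfaceOrderReductionDimLeThree) (p : ℕ) :
    GammaFreeGlobalOrderReductionDimLeThree.{0} p := by
  intro hp k _ _ _ X s hsep hloft hqc hint hreg hdim I hI hIc m hm
  haveI := hloft
  haveI : IsLocallyNoetherian X := LocallyOfFiniteType.isLocallyNoetherian s
  obtain ⟨X', Φ, M', hres⟩ :=
    h p hp k X s hsep hloft hqc hint hreg hdim I hI hIc [] (hasSNC_nil_of_isRegular hreg) m hm
  exact ⟨X', Φ, M'.ideal, isPermissibleBlowupSeq_and_idealOrder_lt_of_isMarkedResolution hres⟩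

end CampaignW46

end Summit.ResolutionOfSingularities.ResolutionOfSingularities.Theorems

end
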